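import Literature.NumberTheory.LFunctions.FeketePolyaKernelCertificatesBlockWrappers
import HarnessLib

/-!
# No real zero for real primitive characters of conductor `19027 ≤ q ≤ 19566`: the Fekete–Pólya rows, in the kernel (rows deferred by the earlier engines)

Topic `Literature/NumberTheory/LFunctions`; namespace `Literature.NumberTheory.LFunctions`. THEOREMS only (no
definition, no named fact, no `sorry`; standard axioms): one PUBLIC theorem **`noRealZero{Odd,Even}_fp_<q>`** per
fundamental discriminant `D`, `|D| = q ∈ [19027, 19566]`, that admits a Fekete–Pólya witness but was DEFERRED by the per-position engines v1/v2 (walk too long for one `decide`) — for every primitive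
quadratic `χ` mod `q` of the parity of `D` and every `σ ∈ (0, 1)`, `L(σ, χ) ≠ 0` (statement shape of the
`interval_cases` bullets of the `NoRealZero{Odd,Even}…` range files, so a range assembly cites them by name).
Cell `parity-realchar`, kernel floor of the wide column (TARGET §2 row 19), Fekete–Pólya lane (seat prover-2).

Method (engine v4): `FeketePolyaKernelCertificatesBlock{,Wrappers}.lean` — the iterated partial sums of order
`K` of the induced character `χ↑(q·w)` are non-negative over one period, decided in the kernel BLOCKWISE on packed
base-`2^b` digits (`blockCert b B K (q·w) (tabs… b ps q w)`: sign tables of the character from the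
quadratic-residue bitsets of the prime factors of the conductor — the factor list is part of each certificate,
primality by `norm_num` — prefix sums by one big-integer multiplication per order and block, sign test by one
AND), hence `ℜL(σ, χ↑(q·w)) > 0` (Fekete–Pólya 1912 / MV §11.2.1 Exercise 7) and `L(σ, χ) ≠ 0` (positive Euler
factors, Exercise 8).  Witnesses `(w, K)` = the cheapest in the exact integer scan of this seat
(`HOME/parity-realchar-prover-2/fp-witnesses-*.tsv`; no kit); the digit width `b` is two bits above the size of
the running-sum bound recorded by the scan.  11 characters in this file (est. 78 kernel-s).
NOT covered here (no Fekete–Pólya witness with `w ≤ 40`, `q·w ≤ 4·10⁵`, `K ≤ 12`; the other Fekete–Pólya rows of this range are in the `NoRealZeroFeketePolyaX…` files) — left to the truncation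
certificates of the companion lane: see those files.

## References

* H. L. Montgomery, R. C. Vaughan, *Multiplicative Number Theory I*, CUP 2007, §9.3 Thm 9.13, §11.2.1
  Exercises 7–8. [MontgomeryVaughan2007]
* M. Fekete, G. Pólya, *Über ein Problem von Laguerre*, Rend. Circ. Mat. Palermo 34 (1912) 89–120. [FeketePolya1912]
-/

namespace Literature.NumberTheory.LFunctions

open FeketePolyaKernel

set_option maxHeartbeats 400000 in
/-- `D = -19027`: the odd character `(·/19027)` of conductor `19027` (`19027`: 53 · 359) — Fekete–Pólya witness of order `8` along the induced modulus `19027·15 = 285405`, block certificate (digits of `123` bits, splitting depth `11`); est. `12.8` kernel-s. [cite: MontgomeryVaughan2007, §11.2.1 Exercises 7 (g), 8] -/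
theorem noRealZeroOdd_fp_19027 :
    ∀ χ : DirichletCharacter ℂ 19027, χ.IsQuadratic → χ.IsPrimitive → χ.Odd →
      ∀ σ : ℝ, 0 < σ → σ < 1 → χ.LFunction σ ≠ 0 :=
  good_odd_of_odd_blk [53, 359] (by norm_num) (by decide) (by decide) 15 8 123 11 (by decide) (by decide) (by decide)
    (Or.inr (by decide +kernel))

set_option maxHeartbeats 400000 in
/-- `D = -19144`: the odd character `χ₋₈·(·/2393)` of conductor `19144` (`2393`: prime) — Fekete–Pólya witness of order `8` along the induced modulus `19144·13 = 248872`, block certificate (digits of `121` bits, splitting depth `10`); est. `11.2` kernel-s. [cite: MontgomeryVaughan2007, §11.2.1 Exercises 7 (g), 8] -/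
theorem noRealZeroOdd_fp_19144 :
    ∀ χ : DirichletCharacter ℂ 19144, χ.IsQuadratic → χ.IsPrimitive → χ.Odd →
      ∀ σ : ℝ, 0 < σ → σ < 1 → χ.LFunction σ ≠ 0 :=
  good_odd_of_eight_blk [2393] (by norm_num) (by decide) (by decide) 13 8 121 10 (by decide) (by decide) (by decide)
    (Or.inr (by decide +kernel)) (Or.inl (by decide +kernel))

set_option maxHeartbeats 400000 in
/-- `D = 19169`: the even character `(·/19169)` of conductor `19169` (`19169`: 29 · 661) — Fekete–Pólya witness of order `5` along the induced modulus `19169·11 = 210859`, block certificate (digits of `74` bits, splitting depth `10`); est. `5.1` kernel-s. [cite: MontgomeryVaughan2007, §11.2.1 Exercises 7 (g), 8] -/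
theorem noRealZeroEven_fp_19169 :
    ∀ χ : DirichletCharacter ℂ 19169, χ.IsQuadratic → χ.IsPrimitive → χ.Even →
      ∀ σ : ℝ, 0 < σ → σ < 1 → χ.LFunction σ ≠ 0 :=
  good_even_of_odd_blk [29, 661] (by norm_num) (by decide) (by decide) 11 5 74 10 (by decide) (by decide) (by decide)
    (Or.inr (by decide +kernel))

set_option maxHeartbeats 400000 in
/-- `D = -19243`: the odd character `(·/19243)` of conductor `19243` (`19243`: 7 · 2749) — Fekete–Pólya witness of order `6` along the induced modulus `19243·10 = 192430`, block certificate (digits of `89` bits, splitting depth `10`); est. `5.8` kernel-s. [cite: MontgomeryVaughan2007, §11.2.1 Exercises 7 (g), 8] -/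
theorem noRealZeroOdd_fp_19243 :
    ∀ χ : DirichletCharacter ℂ 19243, χ.IsQuadratic → χ.IsPrimitive → χ.Odd →
      ∀ σ : ℝ, 0 < σ → σ < 1 → χ.LFunction σ ≠ 0 :=
  good_odd_of_odd_blk [7, 2749] (by norm_num) (by decide) (by decide) 10 6 89 10 (by decide) (by decide) (by decide)
    (Or.inr (by decide +kernel))

set_option maxHeartbeats 400000 in
/-- `D = 19253`: the even character `(·/19253)` of conductor `19253` (`19253`: 13 · 1481) — Fekete–Pólya witness of order `5` along the induced modulus `19253·15 = 288795`, block certificate (digits of `75` bits, splitting depth `11`); est. `6.9` kernel-s. [cite: MontgomeryVaughan2007, §11.2.1 Exercises 7 (g), 8] -/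
theorem noRealZeroEven_fp_19253 :
    ∀ χ : DirichletCharacter ℂ 19253, χ.IsQuadratic → χ.IsPrimitive → χ.Even →
      ∀ σ : ℝ, 0 < σ → σ < 1 → χ.LFunction σ ≠ 0 :=
  good_even_of_odd_blk [13, 1481] (by norm_num) (by decide) (by decide) 15 5 75 11 (by decide) (by decide) (by decide)
    (Or.inr (by decide +kernel))

set_option maxHeartbeats 400000 in
/-- `D = 19277`: the even character `(·/19277)` of conductor `19277` (`19277`: 37 · 521) — Fekete–Pólya witness of order `5` along the induced modulus `19277·5 = 96385`, block certificate (digits of `68` bits, splitting depth `9`); est. `2.3` kernel-s. [cite: MontgomeryVaughan2007, §11.2.1 Exercises 7 (g), 8] -/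
theorem noRealZeroEven_fp_19277 :
    ∀ χ : DirichletCharacter ℂ 19277, χ.IsQuadratic → χ.IsPrimitive → χ.Even →
      ∀ σ : ℝ, 0 < σ → σ < 1 → χ.LFunction σ ≠ 0 :=
  good_even_of_odd_blk [37, 521] (by norm_num) (by decide) (by decide) 5 5 68 9 (by decide) (by decide) (by decide)
    (Or.inr (by decide +kernel))

set_option maxHeartbeats 400000 in
/-- `D = 19365`: the even character `(·/19365)` of conductor `19365` (`19365`: 3 · 5 · 1291) — Fekete–Pólya witness of order `5` along the induced modulus `19365·14 = 271110`, block certificate (digits of `75` bits, splitting depth `11`); est. `6.5` kernel-s. [cite: MontgomeryVaughan2007, §11.2.1 Exercises 7 (g), 8] -/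
theorem noRealZeroEven_fp_19365 :
    ∀ χ : DirichletCharacter ℂ 19365, χ.IsQuadratic → χ.IsPrimitive → χ.Even →
      ∀ σ : ℝ, 0 < σ → σ < 1 → χ.LFunction σ ≠ 0 :=
  good_even_of_odd_blk [3, 5, 1291] (by norm_num) (by decide) (by decide) 14 5 75 11 (by decide) (by decide) (by decide)
    (Or.inr (by decide +kernel))

set_option maxHeartbeats 400000 in
/-- `D = 19373`: the even character `(·/19373)` of conductor `19373` (`19373`: prime) — Fekete–Pólya witness of order `5` along the induced modulus `19373·6 = 116238`, block certificate (digits of `70` bits, splitting depth `9`); est. `3.9` kernel-s. [cite: MontgomeryVaughan2007, §11.2.1 Exercises 7 (g), 8] -/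
theorem noRealZeroEven_fp_19373 :
    ∀ χ : DirichletCharacter ℂ 19373, χ.IsQuadratic → χ.IsPrimitive → χ.Even →
      ∀ σ : ℝ, 0 < σ → σ < 1 → χ.LFunction σ ≠ 0 :=
  good_even_of_odd_blk [19373] (by norm_num) (by decide) (by decide) 6 5 70 9 (by decide) (by decide) (by decide)
    (Or.inr (by decide +kernel))

set_option maxHeartbeats 400000 in
/-- `D = -19416`: the odd character `χ₈·(·/2427)` of conductor `19416` (`2427`: 3 · 809) — Fekete–Pólya witness of order `6` along the induced modulus `19416·11 = 213576`, block certificate (digits of `91` bits, splitting depth `10`); est. `6.4` kernel-s. [cite: MontgomeryVaughan2007, §11.2.1 Exercises 7 (g), 8] -/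
theorem noRealZeroOdd_fp_19416 :
    ∀ χ : DirichletCharacter ℂ 19416, χ.IsQuadratic → χ.IsPrimitive → χ.Odd →
      ∀ σ : ℝ, 0 < σ → σ < 1 → χ.LFunction σ ≠ 0 :=
  good_odd_of_eight_blk [3, 809] (by norm_num) (by decide) (by decide) 11 6 91 10 (by decide) (by decide) (by decide)
    (Or.inl (by decide +kernel)) (Or.inr (by decide +kernel))

set_option maxHeartbeats 400000 in
/-- `D = -19483`: the odd character `(·/19483)` of conductor `19483` (`19483`: prime) — Fekete–Pólya witness of order `7` along the induced modulus `19483·15 = 292245`, block certificate (digits of `108` bits, splitting depth `11`); est. `11.8` kernel-s. [cite: MontgomeryVaughan2007, §11.2.1 Exercises 7 (g), 8] -/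
theorem noRealZeroOdd_fp_19483 :
    ∀ χ : DirichletCharacter ℂ 19483, χ.IsQuadratic → χ.IsPrimitive → χ.Odd →
      ∀ σ : ℝ, 0 < σ → σ < 1 → χ.LFunction σ ≠ 0 :=
  good_odd_of_odd_blk [19483] (by norm_num) (by decide) (by decide) 15 7 108 11 (by decide) (by decide) (by decide)
    (Or.inr (by decide +kernel))

set_option maxHeartbeats 400000 in
/-- `D = -19563`: the odd character `(·/19563)` of conductor `19563` (`19563`: 3 · 6521) — Fekete–Pólya witness of order `5` along the induced modulus `19563·11 = 215193`, block certificate (digits of `74` bits, splitting depth `10`); est. `5.5` kernel-s. [cite: MontgomeryVaughan2007, §11.2.1 Exercises 7 (g), 8] -/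
theorem noRealZeroOdd_fp_19563 :
    ∀ χ : DirichletCharacter ℂ 19563, χ.IsQuadratic → χ.IsPrimitive → χ.Odd →
      ∀ σ : ℝ, 0 < σ → σ < 1 → χ.LFunction σ ≠ 0 :=
  good_odd_of_odd_blk [3, 6521] (by norm_num) (by decide) (by decide) 11 5 74 10 (by decide) (by decide) (by decide)
    (Or.inr (by decide +kernel))

end Literature.NumberTheory.LFunctions
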